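import Mathlib
import Summits.SmoothPoincare4.SmoothPoincare4.Theorems.CylinderEntropyCylinderRungTwoKCertDefsBox
import HarnessLib

/-!
# Kernel certificate checker for `stub_certMid`, IV-a: soundness of the scaled-integer arithmetic

Infrastructure file for the kernel-clean discharge of the registered stub `stub_certMid` of crux stmt-SmoothPoincare4-7631
(`Summit.SmoothPoincare4.SmoothPoincare4.Theses.CylinderEntropy.CylinderRungTwo`, line `killing-flux`).  The box-level
computations of the checker (`…KCertDefs`) are carried in integers `k` standing for `k / 2^64` and in the integer intervals
`MI` (`MI.mem S x I ↔ I.lo ≤ x S ≤ I.hi`); proved here: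

* `zlo64_le`, `le_zhi64`, `mem_ofQ`, `toQ_*` — the scaled floor / ceiling of a rational and the thin interval of a rational;
* `fdiv_le_real`, `le_cdivZ_real`, `mul3lo_le` — floor / ceiling division and the floor of a triple product of nonnegatives;
* `cosI_spec`, `cosAtI_spec` — the fixed-point cosine encloses `cos t` on `[0, π]` (eighteen certified doublings at scale
  `2^104`) and its clamped form encloses `cos (min t π)` with `-1 ≤ lo/S`, `hi/S ≤ 1`.
No named facts.
-/

-- the registered namespace `Summit.SmoothPoincare4.SmoothPoincare4.…` repeats a component
set_option linter.dupNamespace false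

noncomputable section

namespace Summit.SmoothPoincare4.SmoothPoincare4.Cruxes.CylinderRungTwo.KillingFlux

namespace KCert

open Literature.Analysis.ValidatedNumerics.NumericsMP

/-! ### The scale and the scaled roundings -/

/-- `0 < S`. [folklore] -/
theorem S64_pos : 0 < S64 := by unfold S64; norm_num

/-- `0 < S` cast to `ℤ` and to `ℝ`. [folklore] -/
theorem S64_cast_pos : (0 : ℤ) < (S64 : ℤ) ∧ (0 : ℝ) < (S64 : ℝ) := ⟨by exact_mod_cast S64_pos, by exact_mod_cast S64_pos⟩

/-- `⌊qS⌋ ≤ qS`. [folklore] -/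
theorem zlo64_le (q : ℚ) : ((zlo64 q : ℤ) : ℝ) ≤ (q : ℝ) * S64 := by
  unfold zlo64
  have h : ((⌊q * (S64 : ℚ)⌋ : ℤ) : ℚ) ≤ q * (S64 : ℚ) := Int.floor_le _
  have h' : (((⌊q * (S64 : ℚ)⌋ : ℤ) : ℚ) : ℝ) ≤ ((q * (S64 : ℚ) : ℚ) : ℝ) := by exact_mod_cast h
  push_cast at h'
  exact h'

/-- `qS ≤ ⌈qS⌉`. [folklore] -/
theorem le_zhi64 (q : ℚ) : (q : ℝ) * S64 ≤ ((zhi64 q : ℤ) : ℝ) := by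
  unfold zhi64
  have h : q * (S64 : ℚ) ≤ ((⌈q * (S64 : ℚ)⌉ : ℤ) : ℚ) := Int.le_ceil _
  have h' : ((q * (S64 : ℚ) : ℚ) : ℝ) ≤ (((⌈q * (S64 : ℚ)⌉ : ℤ) : ℚ) : ℝ) := by exact_mod_cast h
  push_cast at h'
  exact h'

/-- The thin interval of a rational contains it. [folklore] -/
theorem mem_ofQ (q : ℚ) : MI.mem S64 (q : ℝ) (ofQ q) := ⟨zlo64_le q, le_zhi64 q⟩

/-- A real below a rational is below its scaled ceiling. [folklore] -/
theorem le_zhi64_of_le {x : ℝ} {q : ℚ} (h : x ≤ q) : x * S64 ≤ ((zhi64 q : ℤ) : ℝ) :=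
  le_trans (mul_le_mul_of_nonneg_right h S64_cast_pos.2.le) (le_zhi64 q)

/-- A real above a rational is above its scaled floor. [folklore] -/
theorem zlo64_le_of_le {x : ℝ} {q : ℚ} (h : (q : ℝ) ≤ x) : ((zlo64 q : ℤ) : ℝ) ≤ x * S64 :=
  le_trans (zlo64_le q) (mul_le_mul_of_nonneg_right h S64_cast_pos.2.le)

/-- `toQ k = k / S` in `ℝ`. [folklore] -/
theorem toQ_cast (k : ℤ) : ((toQ k : ℚ) : ℝ) = (k : ℝ) / S64 := by
  unfold toQ; push_cast; rfl

/-- From `lo ≤ xS`: `toQ lo ≤ x`. [folklore] -/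
theorem toQ_le_of {x : ℝ} {lo : ℤ} (h : (lo : ℝ) ≤ x * S64) : ((toQ lo : ℚ) : ℝ) ≤ x := by
  rw [toQ_cast, div_le_iff₀ S64_cast_pos.2]; exact h

/-- From `xS ≤ hi`: `x ≤ toQ hi`. [folklore] -/
theorem le_toQ_of {x : ℝ} {hi : ℤ} (h : x * S64 ≤ (hi : ℝ)) : x ≤ ((toQ hi : ℚ) : ℝ) := by
  rw [toQ_cast, le_div_iff₀ S64_cast_pos.2]; exact h

/-! ### Floor and ceiling division -/

/-- `⌊a/b⌋ ≤ a/b` (`b > 0`). [folklore] -/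
theorem fdiv_le_real (a : ℤ) {b : ℤ} (hb : 0 < b) : ((a / b : ℤ) : ℝ) ≤ (a : ℝ) / b := by
  have hbr : (0 : ℝ) < b := by exact_mod_cast hb
  rw [le_div_iff₀ hbr]
  have h : a / b * b ≤ a := Int.ediv_mul_le a hb.ne'
  exact_mod_cast h

/-- `a/b ≤ ⌈a/b⌉` (`b > 0`). [folklore] -/
theorem le_cdivZ_real (a : ℤ) {b : ℤ} (hb : 0 < b) : (a : ℝ) / b ≤ ((cdivZ a b : ℤ) : ℝ) := by
  unfold cdivZ
  have h := fdiv_le_real (-a) hb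
  push_cast at h ⊢
  rw [neg_div] at h
  linarith

/-- **Floor of a triple product**: for reals `0 ≤ x, y, z` with `a ≤ xS`, `b ≤ yS`, `c ≤ zS` and `0 ≤ a, b, c`,
`mul3lo a b c ≤ x y z S`. [folklore] -/
theorem mul3lo_le {a b c : ℤ} {x y z : ℝ} (ha : 0 ≤ a) (hb : 0 ≤ b) (hc : 0 ≤ c) (hx : (a : ℝ) ≤ x * S64)
    (hy : (b : ℝ) ≤ y * S64) (hz : (c : ℝ) ≤ z * S64) : ((mul3lo a b c : ℤ) : ℝ) ≤ x * y * z * S64 := by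
  have hS := S64_cast_pos.2
  have hSz : (0 : ℤ) < S64 := by exact_mod_cast S64_pos
  have har : (0 : ℝ) ≤ a := by exact_mod_cast ha
  have hbr : (0 : ℝ) ≤ b := by exact_mod_cast hb
  have hcr : (0 : ℝ) ≤ c := by exact_mod_cast hc
  have hx0 : 0 ≤ x := by nlinarith
  have hy0 : 0 ≤ y := by nlinarith
  have hz0 : 0 ≤ z := by nlinarith
  unfold mul3lo
  -- first floor
  have h1 : ((a * b / (S64 : ℤ) : ℤ) : ℝ) ≤ x * y * S64 := by
    refine (fdiv_le_real _ hSz).trans ?_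
    push_cast
    rw [div_le_iff₀ hS]
    calc (a : ℝ) * b ≤ (x * S64) * (y * S64) := mul_le_mul hx hy hbr (har.trans hx)
      _ = x * y * S64 * S64 := by ring
  have h1' : (0 : ℝ) ≤ ((a * b / (S64 : ℤ) : ℤ) : ℝ) := by
    have : (0 : ℤ) ≤ a * b / (S64 : ℤ) := Int.ediv_nonneg (mul_nonneg ha hb) hSz.le
    exact_mod_cast this
  refine (fdiv_le_real _ hSz).trans ?_
  push_cast
  rw [div_le_iff₀ hS]
  calc ((a * b / (S64 : ℤ) : ℤ) : ℝ) * c ≤ (x * y * S64) * (z * S64) := mul_le_mul h1 hz hcr (h1'.trans h1)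
    _ = x * y * z * S64 * S64 := by ring

/-! ### The fixed-point cosine -/

/-- The casts of the `π` enclosure. [folklore] -/
theorem piLo_lt_pi : ((piLo : ℚ) : ℝ) < Real.pi := by
  have := Real.pi_gt_d20; unfold piLo; push_cast; linarith

/-- [folklore] -/
theorem pi_lt_piHi : Real.pi < ((piHi : ℚ) : ℝ) := by
  have := Real.pi_lt_d20; unfold piHi; push_cast; linarith

/-- The doubling step in scaled form: `0 ≤ lo ≤ vW ≤ hi` gives
`⌊(2lo² - W²)/W⌋ ≤ (2v² - 1)W ≤ ⌈(2hi² - W²)/W⌉`. [folklore] -/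
theorem cosStepZ_bounds {W : ℕ} (hW : 0 < W) {lo hi : ℤ} {v : ℝ} (h0 : 0 ≤ lo) (h1 : (lo : ℝ) ≤ v * W)
    (h2 : v * W ≤ (hi : ℝ)) :
    (((2 * lo * lo - (W : ℤ) * W) / W : ℤ) : ℝ) ≤ (2 * v ^ 2 - 1) * W ∧
      (2 * v ^ 2 - 1) * W ≤ ((cdivZ (2 * hi * hi - (W : ℤ) * W) W : ℤ) : ℝ) := by
  have hWr : (0 : ℝ) < W := by exact_mod_cast hW
  have hWz : (0 : ℤ) < W := by exact_mod_cast hW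
  have hlo : (0 : ℝ) ≤ lo := by exact_mod_cast h0
  have hv : 0 ≤ v * W := hlo.trans h1
  constructor
  · refine (fdiv_le_real _ hWz).trans ?_
    push_cast
    rw [div_le_iff₀ hWr]
    have : (lo : ℝ) * lo ≤ (v * W) * (v * W) := mul_le_mul h1 h1 hlo hv
    nlinarith
  · refine le_trans ?_ (le_cdivZ_real _ hWz)
    push_cast
    rw [le_div_iff₀ hWr]
    have : (v * W) * (v * W) ≤ (hi : ℝ) * hi := mul_le_mul h2 h2 hv (hv.trans h2)
    nlinarith

/-- Invariant of the scaled clamped doublings. [folklore] -/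
theorem cosIterZ_spec {W : ℕ} (hW : 0 < W) {t : ℝ} (ht0 : 0 ≤ t) (htπ : t ≤ Real.pi) (c0 : ℤ × ℤ)
    (h0 : (c0.1 : ℝ) ≤ Real.cos (t / 2 ^ 18) * W ∧ Real.cos (t / 2 ^ 18) * W ≤ (c0.2 : ℝ) ∧ 0 ≤ c0.1) :
    ∀ n, n ≤ 17 → ((cosIterZ W c0 n).1 : ℝ) ≤ Real.cos (t / 2 ^ (18 - n)) * W ∧
      Real.cos (t / 2 ^ (18 - n)) * W ≤ ((cosIterZ W c0 n).2 : ℝ) ∧ 0 ≤ (cosIterZ W c0 n).1 := by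
  intro n
  induction n with
  | zero => intro _; simpa [cosIterZ] using h0
  | succ n ih =>
    intro hn
    obtain ⟨h1, h2, h3⟩ := ih (by omega)
    have hk : 18 - n = (17 - n) + 1 := by omega
    rw [hk] at h1 h2
    have hang : t / 2 ^ (17 - n) = 2 * (t / 2 ^ ((17 - n) + 1)) := by rw [pow_succ]; field_simp
    obtain ⟨hb1, hb2⟩ := cosStepZ_bounds hW h3 h1 h2
    have hnn : 0 ≤ Real.cos (t / 2 ^ (17 - n)) := by
      rw [show 17 - n = (16 - n) + 1 by omega]; exact cos_div_pow_succ_nonneg ht0 htπ _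
    rw [show 18 - (n + 1) = 17 - n by omega]
    have hcos : Real.cos (t / 2 ^ (17 - n)) = 2 * Real.cos (t / 2 ^ ((17 - n) + 1)) ^ 2 - 1 := by
      rw [hang, Real.cos_two_mul]
    simp only [cosIterZ, cosStepZ]
    refine ⟨?_, ?_, le_max_left _ _⟩
    · push_cast
      refine max_le (by positivity) ?_
      rw [hcos]; exact_mod_cast hb1
    · rw [hcos]; exact_mod_cast hb2

/-- **The fixed-point cosine encloses `cos t` for `0 ≤ t ≤ π`** (at scale `2^64`). [folklore] -/
theorem cosI_spec {t : ℚ} (ht0 : 0 ≤ t) (htπ : (t : ℝ) ≤ Real.pi) : MI.mem S64 (Real.cos (t : ℝ)) (cosI t) := by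
  have ht0' : (0 : ℝ) ≤ (t : ℝ) := by exact_mod_cast ht0
  have hW : 0 < (2 : ℕ) ^ 104 := by positivity
  have hWr : (0 : ℝ) < ((2 ^ 104 : ℕ) : ℝ) := by exact_mod_cast hW
  have hxabs : |(t : ℝ) / 2 ^ 18| ≤ 1 := by
    rw [abs_of_nonneg (by positivity), div_le_one (by positivity)]
    linarith [Real.pi_lt_four]
  -- base enclosure at scale W
  have hcl : Real.cos ((t : ℝ) / 2 ^ 18) * ((2 ^ 104 : ℕ) : ℝ) ≥
      ((max 0 ⌊(1 - (t / 2 ^ 18) ^ 2 / 2) * (((2 : ℕ) ^ 104 : ℕ) : ℚ)⌋ : ℤ) : ℝ) := by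
    push_cast
    refine max_le ?_ ?_
    · have := cos_div_pow_succ_nonneg ht0' htπ 17
      have : 0 ≤ Real.cos ((t:ℝ) / 2 ^ 18) := by simpa using this
      positivity
    · have hfl : ((⌊(1 - (t / 2 ^ 18) ^ 2 / 2) * (((2 : ℕ) ^ 104 : ℕ) : ℚ)⌋ : ℤ) : ℝ) ≤
          (((1 - (t / 2 ^ 18) ^ 2 / 2) * (((2 : ℕ) ^ 104 : ℕ) : ℚ) : ℚ) : ℝ) := by exact_mod_cast Int.floor_le _
      refine hfl.trans ?_
      push_cast
      have := Real.one_sub_sq_div_two_le_cos (x := (t : ℝ) / 2 ^ 18)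
      exact mul_le_mul_of_nonneg_right this (by positivity)
  have hcu : Real.cos ((t : ℝ) / 2 ^ 18) * ((2 ^ 104 : ℕ) : ℝ) ≤
      ((⌈(1 - (t / 2 ^ 18) ^ 2 / 2 + 5 * (t / 2 ^ 18) ^ 4 / 96) * (((2 : ℕ) ^ 104 : ℕ) : ℚ)⌉ : ℤ) : ℝ) := by
    have hce : ((((1 - (t / 2 ^ 18) ^ 2 / 2 + 5 * (t / 2 ^ 18) ^ 4 / 96) * (((2 : ℕ) ^ 104 : ℕ) : ℚ) : ℚ)) : ℝ) ≤
        ((⌈(1 - (t / 2 ^ 18) ^ 2 / 2 + 5 * (t / 2 ^ 18) ^ 4 / 96) * (((2 : ℕ) ^ 104 : ℕ) : ℚ)⌉ : ℤ) : ℝ) := by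
      exact_mod_cast Int.le_ceil _
    refine le_trans ?_ hce
    push_cast
    have hcb := Real.cos_bound hxabs
    rw [abs_le] at hcb
    have habs4 : |(t : ℝ) / 2 ^ 18| ^ 4 = ((t : ℝ) / 2 ^ 18) ^ 4 := by rw [abs_of_nonneg (by positivity)]
    refine mul_le_mul_of_nonneg_right ?_ (by positivity)
    linarith [hcb.2]
  have h0 : (0 : ℤ) ≤ max 0 ⌊(1 - (t / 2 ^ 18) ^ 2 / 2) * (((2 : ℕ) ^ 104 : ℕ) : ℚ)⌋ := le_max_left _ _
  obtain ⟨h1, h2, h3⟩ := cosIterZ_spec hW ht0' htπ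
    (max 0 ⌊(1 - (t / 2 ^ 18) ^ 2 / 2) * (((2 : ℕ) ^ 104 : ℕ) : ℚ)⌋,
      ⌈(1 - (t / 2 ^ 18) ^ 2 / 2 + 5 * (t / 2 ^ 18) ^ 4 / 96) * (((2 : ℕ) ^ 104 : ℕ) : ℚ)⌉) ⟨hcl, hcu, h0⟩ 17 le_rfl
  rw [show (18 : ℕ) - 17 = 0 + 1 from rfl] at h1 h2
  set c17 := cosIterZ (2 ^ 104)
    (max 0 ⌊(1 - (t / 2 ^ 18) ^ 2 / 2) * (((2 : ℕ) ^ 104 : ℕ) : ℚ)⌋,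
      ⌈(1 - (t / 2 ^ 18) ^ 2 / 2 + 5 * (t / 2 ^ 18) ^ 4 / 96) * (((2 : ℕ) ^ 104 : ℕ) : ℚ)⌉) 17 with hc17
  obtain ⟨hb1, hb2⟩ := cosStepZ_bounds hW h3 h1 h2
  have hcos : Real.cos (t : ℝ) = 2 * Real.cos ((t : ℝ) / 2 ^ (0 + 1)) ^ 2 - 1 := by
    rw [← Real.cos_two_mul]; congr 1; ring
  -- rescale `W = 2^104` to `S = 2^64`
  have hWS : ((2 ^ 104 : ℕ) : ℝ) = (S64 : ℝ) * (2 : ℝ) ^ 40 := by unfold S64; norm_num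
  have h40 : (0 : ℤ) < 2 ^ 40 := by norm_num
  show ((((2 * c17.1 * c17.1 - ((2 ^ 104 : ℕ) : ℤ) * (2 ^ 104 : ℕ)) / (2 ^ 104 : ℕ)) / 2 ^ 40 : ℤ) : ℝ) ≤
      Real.cos (t : ℝ) * S64 ∧
    Real.cos (t : ℝ) * S64 ≤ ((cdivZ (cdivZ (2 * c17.2 * c17.2 - ((2 ^ 104 : ℕ) : ℤ) * (2 ^ 104 : ℕ)) (2 ^ 104 : ℕ)) (2 ^ 40) : ℤ) : ℝ)
  have hlow : (((2 * c17.1 * c17.1 - ((2 ^ 104 : ℕ) : ℤ) * (2 ^ 104 : ℕ)) / (2 ^ 104 : ℕ) : ℤ) : ℝ) ≤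
      Real.cos (t : ℝ) * S64 * ((2 ^ 40 : ℤ) : ℝ) := by
    calc (((2 * c17.1 * c17.1 - ((2 ^ 104 : ℕ) : ℤ) * (2 ^ 104 : ℕ)) / (2 ^ 104 : ℕ) : ℤ) : ℝ)
        ≤ (2 * Real.cos ((t : ℝ) / 2 ^ (0 + 1)) ^ 2 - 1) * ((2 ^ 104 : ℕ) : ℝ) := by exact_mod_cast hb1
      _ = Real.cos (t : ℝ) * S64 * ((2 ^ 40 : ℤ) : ℝ) := by rw [← hcos, hWS]; push_cast; ring
  have hupp : Real.cos (t : ℝ) * S64 * ((2 ^ 40 : ℤ) : ℝ) ≤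
      ((cdivZ (2 * c17.2 * c17.2 - ((2 ^ 104 : ℕ) : ℤ) * (2 ^ 104 : ℕ)) (2 ^ 104 : ℕ) : ℤ) : ℝ) := by
    calc Real.cos (t : ℝ) * S64 * ((2 ^ 40 : ℤ) : ℝ)
        = (2 * Real.cos ((t : ℝ) / 2 ^ (0 + 1)) ^ 2 - 1) * ((2 ^ 104 : ℕ) : ℝ) := by rw [← hcos, hWS]; push_cast; ring
      _ ≤ ((cdivZ (2 * c17.2 * c17.2 - ((2 ^ 104 : ℕ) : ℤ) * (2 ^ 104 : ℕ)) (2 ^ 104 : ℕ) : ℤ) : ℝ) := by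
          exact_mod_cast hb2
  have h40r : (0 : ℝ) < ((2 ^ 40 : ℤ) : ℝ) := by exact_mod_cast h40
  constructor
  · refine (fdiv_le_real _ h40).trans ?_
    rw [div_le_iff₀ h40r]
    exact hlow
  · refine le_trans ?_ (le_cdivZ_real _ h40)
    rw [le_div_iff₀ h40r]
    exact hupp

/-- **The clamped cosine**: for `0 ≤ t`, `cosAtI t` encloses `cos (min t π)`, with `-S ≤ lo` and `hi ≤ S`. [folklore] -/
theorem cosAtI_spec {t : ℚ} (ht : 0 ≤ t) :
    MI.mem S64 (Real.cos (min (t : ℝ) Real.pi)) (cosAtI t) ∧ -(S64 : ℤ) ≤ (cosAtI t).lo ∧ (cosAtI t).hi ≤ S64 := by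
  have hpiLo := piLo_lt_pi
  have hS := S64_cast_pos.2
  unfold cosAtI
  split_ifs with h
  · have htπ : (t : ℝ) ≤ Real.pi := by
      have : ((t : ℚ) : ℝ) < ((piLo : ℚ) : ℝ) := by exact_mod_cast h
      linarith
    rw [min_eq_left htπ]
    dsimp only
    obtain ⟨h1, h2⟩ := cosI_spec ht htπ
    refine ⟨⟨?_, ?_⟩, le_max_left _ _, min_le_left _ _⟩
    · push_cast
      refine max_le ?_ h1
      have := Real.neg_one_le_cos (t : ℝ)
      nlinarith
    · push_cast
      refine le_min ?_ h2
      have := Real.cos_le_one (t : ℝ)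
      nlinarith
  · dsimp only
    have hpl0 : (0 : ℚ) ≤ piLo := by unfold piLo; norm_num
    obtain ⟨_, h2⟩ := cosI_spec hpl0 hpiLo.le
    refine ⟨⟨?_, ?_⟩, le_rfl, min_le_left _ _⟩
    · push_cast
      have := Real.neg_one_le_cos (min (t : ℝ) Real.pi)
      nlinarith
    · push_cast
      refine le_min ?_ ?_
      · have := Real.cos_le_one (min (t : ℝ) Real.pi); nlinarith
      · have hlo : ((piLo : ℚ) : ℝ) ≤ min (t : ℝ) Real.pi := le_min (by exact_mod_cast not_lt.1 h) hpiLo.le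
        have hcos := Real.cos_le_cos_of_nonneg_of_le_pi (by exact_mod_cast hpl0) (min_le_right _ _) hlo
        exact le_trans (mul_le_mul_of_nonneg_right hcos hS.le) h2

end KCert


/-- Registered sub-goal marker `stub_certMid_part4` of crux stmt-SmoothPoincare4-7631 (helper file 4 of the kernel-clean
`stub_certMid`, line killing-flux): the half-angle cosines of the certified fixed-point cosine are nonnegative. [folklore] -/
theorem stub_certMid_part4 : ∀ t : ℝ, 0 ≤ t → t ≤ Real.pi → 0 ≤ Real.cos (t / 2 ^ (0 + 1)) :=
  fun _ h0 h1 => KCert.cos_div_pow_succ_nonneg h0 h1 0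

end Summit.SmoothPoincare4.SmoothPoincare4.Cruxes.CylinderRungTwo.KillingFlux

end
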